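import Summits.PneNP.PneNP.Theses.OneSlice
import Literature.Combinatorics.SetFamily.BiasedMeasure

/-!
# Negative lemmas for crux `SliceACZero` (stmt-PneNP-2835), Part VIII-A: slice densities of a down-set
versus the biased (binomial-mixture) measure

A monotone comparison used to move `G(n,q)` facts onto a single Hamming slice:

* `card_slice_succ_div_choose_le` — for a DOWN-SET `𝒟 ⊆ 2^α`, the slice densities
  `d_r = #(𝒟 # r)/C(N,r)` are non-increasing in `r` (the local LYM inequality of Mathlib applied to
  `𝒟 # (r+1)`, whose shadow lies in `𝒟 # r`); iterated: `card_slice_div_choose_antitone`.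
* `sum_range_choose_mul_pow_mul_pow` (total binomial mass `= 1`), `sum_range_mul_choose_mul_pow`
  (mean `= N q`), `binomial_upper_tail_le` (Markov: `P[Bin(N,q) ≥ j+1] ≤ N q/(j+1)`).
* `sum_biasedWeight_eq_sum_card_slice` — `μ_q(𝒟) = Σ_r #(𝒟 # r) q^r (1−q)^{N−r}`.
* **`card_slice_div_choose_le_two_mul_sum_biasedWeight`** — for a down-set `𝒟` and `1 ≤ j ≤ N`:
  `d_j(𝒟) ≤ 2 · μ_{j/(2N)}(𝒟)` (the mixture puts mass `≥ 1/2` on the levels `≤ j` by Markov, and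
  there the densities are `≥ d_j`).

The dual for up-sets (densities non-decreasing; compare at `q = 2j/N`) is symmetric and not needed
here. Reusable beyond this crux (any transfer of a monotone-event estimate from `G(n,q)` to `G(n,j)`);
consumed by `WindowHigh.lean` (the upper edge of the window of `Conc`). Sorry-free, standard axioms;
nothing here mentions a Theses decl. Refuter seat cdisprove-stmt-PneNP-2835 (gen 2), 2026-08-16.
-/

noncomputable section

namespace Summit.PneNP.PneNP.Theorems.SliceACZero.Negative

open Finset Literature.Combinatorics.SetFamily
open scoped FinsetFamily

section Density

variable {α : Type*} [DecidableEq α] [Fintype α]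

/-- **Slice densities of a down-set are non-increasing** (one step): local LYM for `𝒟 # (r+1)`,
whose shadow lies in `𝒟 # r`. [folklore] -/
theorem card_slice_succ_div_choose_le (𝒟 : Finset (Finset α))
    (h𝒟 : IsLowerSet (𝒟 : Set (Finset α))) (r : ℕ) :
    (#(𝒟 # (r + 1)) : ℝ) / (Fintype.card α).choose (r + 1) ≤
      (#(𝒟 # r) : ℝ) / (Fintype.card α).choose r := by
  have hsz : ((𝒟 # (r + 1) : Finset (Finset α)) : Set (Finset α)).Sized (r + 1) := sized_slice
  have hlym : (#(𝒟 # (r + 1)) : ℝ) / (Fintype.card α).choose (r + 1) ≤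
      (#(∂ (𝒟 # (r + 1))) : ℝ) / (Fintype.card α).choose r := by
    have := Finset.local_lubell_yamamoto_meshalkin_inequality_div (𝕜 := ℝ)
      (Nat.succ_ne_zero r) hsz
    simpa using this
  refine hlym.trans (div_le_div_of_nonneg_right ?_ (Nat.cast_nonneg _))
  have hsub : ∂ (𝒟 # (r + 1)) ⊆ 𝒟 # r := by
    intro t ht
    rw [mem_shadow_iff] at ht
    obtain ⟨s, hs, a, ha, rfl⟩ := ht
    rw [mem_slice] at hs ⊢
    refine ⟨h𝒟 (erase_subset a s) hs.1, ?_⟩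
    rw [card_erase_of_mem ha, hs.2, Nat.add_sub_cancel]
  exact_mod_cast card_le_card hsub

/-- **Slice densities of a down-set are non-increasing.** [folklore] -/
theorem card_slice_div_choose_antitone (𝒟 : Finset (Finset α))
    (h𝒟 : IsLowerSet (𝒟 : Set (Finset α))) {ℓ j : ℕ} (h : ℓ ≤ j) :
    (#(𝒟 # j) : ℝ) / (Fintype.card α).choose j ≤ (#(𝒟 # ℓ) : ℝ) / (Fintype.card α).choose ℓ := by
  induction j, h using Nat.le_induction with
  | base => exact le_rfl
  | succ j _ ih => exact (card_slice_succ_div_choose_le 𝒟 h𝒟 j).trans ih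

end Density

section Binomial

/-- Total binomial mass: `Σ_{r ≤ N} C(N,r) q^r (1−q)^{N−r} = 1`. [folklore] -/
theorem sum_range_choose_mul_pow_mul_pow (N : ℕ) (q : ℝ) :
    ∑ r ∈ range (N + 1), (N.choose r : ℝ) * q ^ r * (1 - q) ^ (N - r) = 1 := by
  calc ∑ r ∈ range (N + 1), (N.choose r : ℝ) * q ^ r * (1 - q) ^ (N - r)
      = ∑ m ∈ range (N + 1), q ^ m * (1 - q) ^ (N - m) * (N.choose m : ℝ) :=
        Finset.sum_congr rfl fun r _ => by ring
    _ = (q + (1 - q)) ^ N := (add_pow q (1 - q) N).symm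
    _ = 1 := by norm_num

/-- Binomial mean as a finite sum: `Σ_{r ≤ N} r · C(N,r) q^r (1−q)^{N−r} = N q`. [folklore] -/
theorem sum_range_mul_choose_mul_pow (N : ℕ) (q : ℝ) :
    ∑ r ∈ range (N + 1), (r : ℝ) * ((N.choose r : ℝ) * q ^ r * (1 - q) ^ (N - r)) = N * q := by
  cases N with
  | zero => simp
  | succ M =>
    rw [Finset.sum_range_succ', Nat.cast_zero, zero_mul, add_zero]
    have hterm : ∀ s ∈ range (M + 1),
        ((s + 1 : ℕ) : ℝ) * (((M + 1).choose (s + 1) : ℝ) * q ^ (s + 1) * (1 - q) ^ (M + 1 - (s + 1))) =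
          ((M + 1 : ℕ) : ℝ) * q * ((M.choose s : ℝ) * q ^ s * (1 - q) ^ (M - s)) := by
      intro s _
      have hc : ((M + 1 : ℕ) : ℝ) * (M.choose s : ℝ) = ((M + 1).choose (s + 1) : ℝ) * ((s + 1 : ℕ) : ℝ) := by
        exact_mod_cast Nat.add_one_mul_choose_eq M s
      rw [show M + 1 - (s + 1) = M - s by omega, pow_succ]
      have : ((s + 1 : ℕ) : ℝ) * ((M + 1).choose (s + 1) : ℝ) = ((M + 1 : ℕ) : ℝ) * (M.choose s : ℝ) := by
        rw [hc]; ring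
      calc ((s + 1 : ℕ) : ℝ) * (((M + 1).choose (s + 1) : ℝ) * (q ^ s * q) * (1 - q) ^ (M - s))
          = (((s + 1 : ℕ) : ℝ) * ((M + 1).choose (s + 1) : ℝ)) * (q ^ s * q) * (1 - q) ^ (M - s) := by
            ring
        _ = (((M + 1 : ℕ) : ℝ) * (M.choose s : ℝ)) * (q ^ s * q) * (1 - q) ^ (M - s) := by rw [this]
        _ = _ := by ring
    rw [Finset.sum_congr rfl hterm, ← Finset.mul_sum, sum_range_choose_mul_pow_mul_pow, mul_one]

/-- **Markov for the binomial upper tail**: `P[Bin(N,q) ≥ j+1] ≤ N q/(j+1)` (`0 ≤ q ≤ 1`), the tail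
written as the finite sum over `Ico (j+1) (N+1)`. [folklore] -/
theorem binomial_upper_tail_le (N j : ℕ) {q : ℝ} (hq0 : 0 ≤ q) (hq1 : q ≤ 1) :
    ∑ r ∈ Ico (j + 1) (N + 1), (N.choose r : ℝ) * q ^ r * (1 - q) ^ (N - r) ≤
      N * q / ((j : ℝ) + 1) := by
  have hB : ∀ r, 0 ≤ (N.choose r : ℝ) * q ^ r * (1 - q) ^ (N - r) := fun r =>
    mul_nonneg (mul_nonneg (Nat.cast_nonneg _) (pow_nonneg hq0 _)) (pow_nonneg (by linarith) _)
  have hj1 : (0 : ℝ) < (j : ℝ) + 1 := by positivity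
  rw [le_div_iff₀ hj1]
  calc (∑ r ∈ Ico (j + 1) (N + 1), (N.choose r : ℝ) * q ^ r * (1 - q) ^ (N - r)) * ((j : ℝ) + 1)
      = ∑ r ∈ Ico (j + 1) (N + 1), ((j : ℝ) + 1) * ((N.choose r : ℝ) * q ^ r * (1 - q) ^ (N - r)) := by
        rw [Finset.sum_mul]
        exact Finset.sum_congr rfl fun r _ => by ring
    _ ≤ ∑ r ∈ Ico (j + 1) (N + 1), (r : ℝ) * ((N.choose r : ℝ) * q ^ r * (1 - q) ^ (N - r)) := by
        refine Finset.sum_le_sum fun r hr => ?_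
        rw [Finset.mem_Ico] at hr
        have : (j : ℝ) + 1 ≤ r := by exact_mod_cast hr.1
        exact mul_le_mul_of_nonneg_right this (hB r)
    _ ≤ ∑ r ∈ range (N + 1), (r : ℝ) * ((N.choose r : ℝ) * q ^ r * (1 - q) ^ (N - r)) := by
        refine Finset.sum_le_sum_of_subset_of_nonneg ?_ fun r _ _ => mul_nonneg (Nat.cast_nonneg _) (hB r)
        intro r hr
        rw [Finset.mem_Ico] at hr
        exact Finset.mem_range.2 hr.2
    _ = N * q := sum_range_mul_choose_mul_pow N q

end Binomial

section Mixture

variable {α : Type*} [DecidableEq α] [Fintype α]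

omit [DecidableEq α] in
/-- **The biased measure of a family is the binomial mixture of its slice counts**:
`μ_q(𝒟) = Σ_{r ≤ N} #(𝒟 # r) · q^r (1−q)^{N−r}`. [folklore] -/
theorem sum_biasedWeight_eq_sum_card_slice (𝒟 : Finset (Finset α)) (q : ℝ) :
    ∑ W ∈ 𝒟, biasedWeight q W =
      ∑ r ∈ range (Fintype.card α + 1),
        (#(𝒟 # r) : ℝ) * (q ^ r * (1 - q) ^ (Fintype.card α - r)) := by
  have hmaps : ∀ W ∈ 𝒟, #W ∈ range (Fintype.card α + 1) := fun W _ =>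
    Finset.mem_range.2 (Nat.lt_succ_of_le (Finset.card_le_univ W))
  rw [← Finset.sum_fiberwise_of_maps_to hmaps]
  refine Finset.sum_congr rfl fun r _ => ?_
  have hset : (𝒟.filter fun W => #W = r) = 𝒟 # r := rfl
  rw [hset]
  have hconst : ∀ W ∈ 𝒟 # r, biasedWeight q W = q ^ r * (1 - q) ^ (Fintype.card α - r) := by
    intro W hW
    rw [mem_slice] at hW
    rw [biasedWeight, hW.2]
  rw [Finset.sum_congr rfl hconst, Finset.sum_const, nsmul_eq_mul]

/-- **Slice density of a down-set ≤ twice its biased measure at half the matched density.**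
For a down-set `𝒟 ⊆ 2^α` and `1 ≤ j ≤ N = |α|`:
`#(𝒟 # j)/C(N,j) ≤ 2 · μ_{j/(2N)}(𝒟)`. Proof: `μ_q(𝒟) = Σ_r d_r C(N,r) q^r(1−q)^{N−r}
≥ d_j · P[Bin(N,q) ≤ j] ≥ d_j · (1 − Nq/(j+1)) ≥ d_j/2` (densities antitone; Markov with
`Nq = j/2`). [folklore] -/
theorem card_slice_div_choose_le_two_mul_sum_biasedWeight (𝒟 : Finset (Finset α))
    (h𝒟 : IsLowerSet (𝒟 : Set (Finset α))) {j : ℕ} (hj : 1 ≤ j) (hjN : j ≤ Fintype.card α) :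
    (#(𝒟 # j) : ℝ) / (Fintype.card α).choose j ≤
      2 * ∑ W ∈ 𝒟, biasedWeight ((j : ℝ) / (2 * Fintype.card α)) W := by
  set N := Fintype.card α with hNdef
  set q : ℝ := (j : ℝ) / (2 * N) with hqdef
  have hN0 : (0 : ℝ) < N := by exact_mod_cast (show 0 < N by omega)
  have hq0 : 0 ≤ q := by positivity
  have hq1 : q ≤ 1 := by
    rw [hqdef, div_le_one (by positivity)]
    have : (j : ℝ) ≤ N := by exact_mod_cast hjN
    linarith
  have hNq : (N : ℝ) * q = j / 2 := by
    rw [hqdef]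
    field_simp
  set B : ℕ → ℝ := fun r => (N.choose r : ℝ) * q ^ r * (1 - q) ^ (N - r) with hBdef
  have hB0 : ∀ r, 0 ≤ B r := fun r =>
    mul_nonneg (mul_nonneg (Nat.cast_nonneg _) (pow_nonneg hq0 _)) (pow_nonneg (by linarith) _)
  set d : ℕ → ℝ := fun r => (#(𝒟 # r) : ℝ) / (N.choose r : ℝ) with hddef
  have hd0 : ∀ r, 0 ≤ d r := fun r => div_nonneg (Nat.cast_nonneg _) (Nat.cast_nonneg _)
  -- the mixture, rewritten with densities
  have hmix : ∑ W ∈ 𝒟, biasedWeight q W = ∑ r ∈ range (N + 1), d r * B r := by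
    rw [sum_biasedWeight_eq_sum_card_slice]
    refine Finset.sum_congr rfl fun r hr => ?_
    have hrN : r ≤ N := Nat.lt_succ_iff.1 (Finset.mem_range.1 hr)
    have hc : (N.choose r : ℝ) ≠ 0 := by exact_mod_cast (Nat.choose_pos hrN).ne'
    simp only [hddef, hBdef, ← hNdef]
    rw [div_mul_eq_mul_div, eq_div_iff hc]
    ring
  -- lower levels carry density ≥ d j
  have hlow : d j * ∑ r ∈ range (j + 1), B r ≤ ∑ r ∈ range (j + 1), d r * B r := by
    rw [Finset.mul_sum]
    refine Finset.sum_le_sum fun r hr => ?_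
    have hrj : r ≤ j := Nat.lt_succ_iff.1 (Finset.mem_range.1 hr)
    exact mul_le_mul_of_nonneg_right (card_slice_div_choose_antitone 𝒟 h𝒟 hrj) (hB0 r)
  have hsub : ∑ r ∈ range (j + 1), d r * B r ≤ ∑ r ∈ range (N + 1), d r * B r :=
    Finset.sum_le_sum_of_subset_of_nonneg
      (Finset.range_subset_range.2 (Nat.succ_le_succ hjN)) fun r _ _ => mul_nonneg (hd0 r) (hB0 r)
  -- mass of the lower levels ≥ 1/2
  have hsplit : ∑ r ∈ range (j + 1), B r + ∑ r ∈ Ico (j + 1) (N + 1), B r = 1 := by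
    rw [Finset.sum_range_add_sum_Ico _ (Nat.succ_le_succ hjN)]
    exact sum_range_choose_mul_pow_mul_pow N q
  have htail : ∑ r ∈ Ico (j + 1) (N + 1), B r ≤ 1 / 2 := by
    refine (binomial_upper_tail_le N j hq0 hq1).trans ?_
    rw [hNq, div_le_iff₀ (by positivity : (0 : ℝ) < (j : ℝ) + 1)]
    have : (0 : ℝ) ≤ j := Nat.cast_nonneg _
    linarith
  have hmass : 1 / 2 ≤ ∑ r ∈ range (j + 1), B r := by linarith
  -- assemble
  have hdj : d j * (1 / 2) ≤ ∑ W ∈ 𝒟, biasedWeight q W := by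
    calc d j * (1 / 2) ≤ d j * ∑ r ∈ range (j + 1), B r :=
          mul_le_mul_of_nonneg_left hmass (hd0 j)
      _ ≤ ∑ r ∈ range (j + 1), d r * B r := hlow
      _ ≤ ∑ r ∈ range (N + 1), d r * B r := hsub
      _ = ∑ W ∈ 𝒟, biasedWeight q W := hmix.symm
  have : d j ≤ 2 * ∑ W ∈ 𝒟, biasedWeight q W := by linarith
  simpa [hddef] using this

end Mixture

end Summit.PneNP.PneNP.Theorems.SliceACZero.Negative

end
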